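import Summits.HubbardSuperconductivity.HubbardSuperconductivity.Theorems.AnisotropyChordTransferFibre3TwoHoleBSNearInf
import Summits.HubbardSuperconductivity.HubbardSuperconductivity.Theorems.AnisotropyChordTransferFibre3DyadicRateSharp

/-!
# Route `AnisotropyChord` / H0 rotor rung: the near-pair tail certificate with the SHARP periodisation rate — error coefficient `O(ρmax·ln L/L²)`

Thirteenth file of the `TwoHoleBS` chain.  `…TwoHoleBSNear.dualCert_threeQuarter_near` and `…TwoHoleBSNearInf.dualCert_threeQuarter_near_inf`
restated with the periodisation input taken from `Subsample.abs_aKer_sub_aZ2_le_sharp` (`|a^{(L)}_0 − aZ2| ≤ 3(8K₂(1 + ln 2 + ln L) + 3π²)ρ/(8L²)`,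
`K₂ = π²/2 + 53π⁴/8 + 6π⁶`) instead of `abs_aKer_sub_aZ2_le` (`2C₀ρ/L`): the error coefficient of the skeleton margin becomes
`ε♯(L,d) = 2ρmax(11.71 ln L + 5.9)/L² + 3(8K₂(1 + ln 2 + ln L) + 3π²)ρmax/(4L²) = O(ρmax ln L/L²)`:
* ★★★ `dualCert_threeQuarter_near_sharp` (capacity parameter `Λup` free), ★★★ `dualCert_threeQuarter_near_inf_sharp` (`L`-free skeleton
  facts + the two scalar thresholds `ε♯(L,d) ≤ ε₀`, `4H_{⌊L/2⌋}s ≥ 2`).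
Prover seat `hubbard-h0-rotor-p2` g2; helper for stmt-19089. WHAT THIS IS NOT: nothing here proves superconductivity in the Hubbard
model (rotor TARGET stays FALSE, g15); HOLE₂(.75) near pairs ⟸ ℤ² skeleton numerics, now with a realistic `L`-threshold shape
(constants still crude: `K₂ ≈ 6.4·10³`, capacity `4H`). No sorry, no axioms.
-/

set_option linter.dupNamespace false

noncomputable section

open scoped BigOperators
open Complex Finset

namespace Summit.HubbardSuperconductivity.HubbardSuperconductivity.Theorems.AnisotropyChord.Transfer.Fibre3

namespace TwoHoleBS

variable (L : ℕ) [NeZero L]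

/-- ★★★ **NEAR-PAIR TAIL CERTIFICATE, SHARP RATE** (`g = ¾ε₁`, pair `(z, z + d)`, `8 ≤ L`): as `dualCert_threeQuarter_near` with the
periodisation bound `δper = 3(8K₂(1 + ln 2 + ln L) + 3π²)ρmax/(4L²)` (`Subsample.abs_aKer_sub_aZ2_le_sharp`). [folklore] -/
theorem dualCert_threeQuarter_near_sharp (hL : 8 ≤ L) (z : Tor L) (d : ℤ × ℤ) (Λup : ℝ)
    (hA : IsUnit (skelA d).det)
    (hcap : 4 * (harmonic (L / 2) : ℝ) ≤ Λup) (hΛ : Λup * TwoChannel.svec2 (skelA d) - 1 ≠ 0)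
    (hpos : ∀ w : Fin 4 ⊕ Fin 4 → ℝ,
      (2 * (rhoMax d * (11.71 * Real.log L + 5.9) / (L : ℝ) ^ 2)
          + 3 * (8 * (Real.pi ^ 2 / 2 + 53 * Real.pi ^ 4 / 8 + 6 * Real.pi ^ 6) * (1 + Real.log 2 + Real.log L)
              + 3 * Real.pi ^ 2) * rhoMax d / (4 * (L : ℝ) ^ 2))
        * (∑ p : Fin 5 ⊕ Fin 5, |(smInv (skelA d) Λup).mulVec (pad w) p|) ^ 2
        ≤ dotProduct w ((TwoChannel.twoHoleP (skelA d) Λup).mulVec w)) :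
    DualCert L (3 / 4 * eps1 L) z (z + castPt L d) := by
  have hL1 : (1 : ℝ) ≤ L := by exact_mod_cast (show 1 ≤ L by omega)
  have hLpos : (0 : ℝ) < L := by linarith
  have he := RateLemma.eps1_pos_of_two_le L (by omega)
  have hlog : 0 ≤ 11.71 * Real.log L + 5.9 := by
    have := Real.log_nonneg hL1
    positivity
  have hlogL : 0 ≤ Real.log L := Real.log_nonneg hL1
  have hlog2 : 0 ≤ Real.log 2 := Real.log_nonneg (by norm_num)
  refine dualCert_threeQuarter_of_tail L hL z (z + castPt L d) (skelA d) (skelA_isSymm d) hA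
    (rhoMax d * (11.71 * Real.log L + 5.9) / (L : ℝ) ^ 2)
    (3 * (8 * (Real.pi ^ 2 / 2 + 53 * Real.pi ^ 4 / 8 + 6 * Real.pi ^ 6) * (1 + Real.log 2 + Real.log L)
      + 3 * Real.pi ^ 2) * rhoMax d / (4 * (L : ℝ) ^ 2)) Λup
    (fun p q => ?_) (fun p q => ?_) hcap hΛ hpos
  · rw [bsPt_sub_eq_castPt]
    unfold castPt
    have h := RateLemma.shellMajorant_holds L hL (2 * (3 / 4 * eps1 L)) (by positivity) (by linarith)
      (ipt d p - ipt d q).1 (ipt d p - ipt d q).2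
    refine h.trans ?_
    rw [mul_div_assoc, mul_div_assoc]
    exact mul_le_mul_of_nonneg_right (normSq_ipt_sub_le d p q) (by positivity)
  · rw [bsPt_sub_eq_castPt]
    simp only [skelA, Matrix.of_apply]
    unfold castPt
    have h := Subsample.abs_aKer_sub_aZ2_le_sharp L (ipt d p - ipt d q).1 (ipt d p - ipt d q).2
    have hC : (0 : ℝ) ≤ 3 * (8 * (Real.pi ^ 2 / 2 + 53 * Real.pi ^ 4 / 8 + 6 * Real.pi ^ 6)
        * (1 + Real.log 2 + Real.log L) + 3 * Real.pi ^ 2) := by positivity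
    rw [← mul_sub, abs_mul, abs_two]
    have hρ := normSq_ipt_sub_le d p q
    calc 2 * |aKer L 0 ((((ipt d p - ipt d q).1 : ℤ) : ZMod L), (((ipt d p - ipt d q).2 : ℤ) : ZMod L))
          - Subsample.aZ2 (ipt d p - ipt d q).1 (ipt d p - ipt d q).2|
        ≤ 2 * (3 * (8 * (Real.pi ^ 2 / 2 + 53 * Real.pi ^ 4 / 8 + 6 * Real.pi ^ 6) * (1 + Real.log 2 + Real.log L)
            + 3 * Real.pi ^ 2) * ((((ipt d p - ipt d q).1 : ℤ) : ℝ) ^ 2 + (((ipt d p - ipt d q).2 : ℤ) : ℝ) ^ 2)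
            / (8 * (L : ℝ) ^ 2)) := by gcongr
      _ ≤ 2 * (3 * (8 * (Real.pi ^ 2 / 2 + 53 * Real.pi ^ 4 / 8 + 6 * Real.pi ^ 6) * (1 + Real.log 2 + Real.log L)
            + 3 * Real.pi ^ 2) * rhoMax d / (8 * (L : ℝ) ^ 2)) := by gcongr
      _ = _ := by ring

/-- ★★★ **NEAR-PAIR TAIL CERTIFICATE, `L`-FREE SKELETON FORM, SHARP RATE:** as `dualCert_threeQuarter_near_inf` with the scalar
threshold on the sharp error coefficient `ε♯(L,d) = 2ρmax(11.71 ln L + 5.9)/L² + 3(8K₂(1 + ln 2 + ln L) + 3π²)ρmax/(4L²)`. [folklore] -/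
theorem dualCert_threeQuarter_near_inf_sharp (hL : 8 ≤ L) (z : Tor L) (d : ℤ × ℤ) (ε₀ : ℝ)
    (hA : IsUnit (skelA d).det) (hs : 0 < TwoChannel.svec2 (skelA d))
    (hcap : 2 ≤ 4 * (harmonic (L / 2) : ℝ) * TwoChannel.svec2 (skelA d))
    (hε : 2 * (rhoMax d * (11.71 * Real.log L + 5.9) / (L : ℝ) ^ 2)
          + 3 * (8 * (Real.pi ^ 2 / 2 + 53 * Real.pi ^ 4 / 8 + 6 * Real.pi ^ 6) * (1 + Real.log 2 + Real.log L)
              + 3 * Real.pi ^ 2) * rhoMax d / (4 * (L : ℝ) ^ 2) ≤ ε₀)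
    (hpos : ∀ w : Fin 4 ⊕ Fin 4 → ℝ,
      ε₀ * (Ninf (skelA d) w) ^ 2 ≤ dotProduct w ((twoHolePinf (skelA d)).mulVec w)) :
    DualCert L (3 / 4 * eps1 L) z (z + castPt L d) := by
  have hL1 : (1 : ℝ) ≤ L := by exact_mod_cast (show 1 ≤ L by omega)
  have hlog : 0 ≤ 11.71 * Real.log L + 5.9 := by
    have := Real.log_nonneg hL1
    positivity
  have hlogL : 0 ≤ Real.log L := Real.log_nonneg hL1
  have hlog2 : 0 ≤ Real.log 2 := Real.log_nonneg (by norm_num)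
  have hρ := rhoMax_nonneg d
  have hεnn : 0 ≤ 2 * (rhoMax d * (11.71 * Real.log L + 5.9) / (L : ℝ) ^ 2)
      + 3 * (8 * (Real.pi ^ 2 / 2 + 53 * Real.pi ^ 4 / 8 + 6 * Real.pi ^ 6) * (1 + Real.log 2 + Real.log L)
          + 3 * Real.pi ^ 2) * rhoMax d / (4 * (L : ℝ) ^ 2) := by positivity
  have hΛs : 1 < 4 * (harmonic (L / 2) : ℝ) * TwoChannel.svec2 (skelA d) := by linarith
  refine dualCert_threeQuarter_near_sharp L hL z d (4 * (harmonic (L / 2) : ℝ)) hA le_rfl (by linarith) fun w => ?_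
  have h1 := l1_smInv_le (skelA d) (4 * (harmonic (L / 2) : ℝ)) hs hcap w
  have h0 : 0 ≤ ∑ p, |(smInv (skelA d) (4 * (harmonic (L / 2) : ℝ))).mulVec (pad w) p| :=
    Finset.sum_nonneg fun p _ => abs_nonneg _
  have h2 : (∑ p, |(smInv (skelA d) (4 * (harmonic (L / 2) : ℝ))).mulVec (pad w) p|) ^ 2 ≤ (Ninf (skelA d) w) ^ 2 :=
    pow_le_pow_left₀ h0 h1 2
  have h3 := twoHoleP_quad_ge_inf (skelA d) (4 * (harmonic (L / 2) : ℝ)) hs hΛs w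
  have h4 := hpos w
  have hN : 0 ≤ (Ninf (skelA d) w) ^ 2 := sq_nonneg _
  calc _ ≤ (2 * (rhoMax d * (11.71 * Real.log L + 5.9) / (L : ℝ) ^ 2)
          + 3 * (8 * (Real.pi ^ 2 / 2 + 53 * Real.pi ^ 4 / 8 + 6 * Real.pi ^ 6) * (1 + Real.log 2 + Real.log L)
              + 3 * Real.pi ^ 2) * rhoMax d / (4 * (L : ℝ) ^ 2)) * (Ninf (skelA d) w) ^ 2 :=
        mul_le_mul_of_nonneg_left h2 hεnn
    _ ≤ ε₀ * (Ninf (skelA d) w) ^ 2 := mul_le_mul_of_nonneg_right hε hN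
    _ ≤ _ := h4.trans h3

end TwoHoleBS

end Summit.HubbardSuperconductivity.HubbardSuperconductivity.Theorems.AnisotropyChord.Transfer.Fibre3

end
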